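import Summits.CriticalPhenomena.Ising3DConformalLimit.Theses.BallOrbitComparison

/-!
# Crux `BallOrbitComparison.BallLimits` (stmt-CriticalPhenomena-5045) — birth skeleton `Lines/birth.lean`

Skeleton registrar `planner-skel-stmt-CriticalPhenomena-5045-0`, 2026-08-17 (route re-audit bin REPAIRABLE;
route `route-CriticalPhenomena-BallOrbitComparison`, sub-problem `Ising3DConformalLimit`).

The crux (rank 3, card D2 "finite-volume form"): for every `R > 0` there is `S_R : CorrFamily 3` such that
for every `n` the `ρ_c`-renormalised `+` b.c. correlations of the FINITE lattice ball `{z : |δz| < R}`,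
`F_δ(x) := ρ_c(δ)ⁿ · G_{B_R}^δ([x₁/δ],…,[xₙ/δ])`, `ρ_c(δ) = ⟨σ₀σ_{⌊1/δ⌋e₀}⟩_{β_c}^{-1/2}`, converge
LOCALLY UNIFORMLY on `K_{R,n} := NonCoincident 3 n ∩ (B_R)ⁿ` to `S_R n` as `δ → 0⁺`, and `S_R n` is
continuous on `K_{R,n}`.

## The line — the route's own two-layer plan `BallTightness → BallUniqueness → BallLimits`, with the
## tightness node cut into its two analytic halves (boundedness = hyperscaling, regularity = equicontinuity)

`BallLimits ⟺ (B) ∧ (E) ∧ (U)` — an EXACT decomposition into three registered stubs, each a consequence of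
the crux (`stubs_of_BallLimits`, proved below) and none sufficient alone (BC3 probes):

* (B) `stub_ballHyperscalingBound` — EVENTUAL LOCAL BOUNDEDNESS under the bulk normalisation: on every compact
  `K' ⊆ K_{R,n}` the renormalised ball correlations are `O(1)` as `δ → 0⁺`. At `n = 1` this is two-point
  HYPERSCALING `⟨σ_x⟩⁺_{B_{R/δ}} ≲ ⟨σ₀σ_{⌊1/δ⌋e₀}⟩^{1/2}` at macroscopic distance from the `+` sphere
  (one-arm ≤ √two-point) — exactly the crux's recorded why-might-fail and the route's kill criterion (c);
  OPEN on `ℤ³` (no one-arm bound at all: arXiv:2406.15243, Open problem 1). Higher `n` reduce to `n ≤ 2`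
  morally by the Gaussian (Newman) inequality with a ghost spin.
* (E) `stub_ballEquicontinuity` — ASYMPTOTIC EQUICONTINUITY on compacts, uniform in the mesh: oscillations of
  `F_δ` below a macroscopic scale `η` are eventually `< ε` (sup-metric on configurations). Macroscopic Hölder-type
  regularity of renormalised critical correlations uniformly in `δ`: in 2D from RSW/discrete holomorphicity
  (Chelkak–Hongler–Izyurov 2015), OPEN in 3D (no RSW theory; Messager–Miracle-Solé monotonicity gives only
  one-sided axis/diagonal monotonicity, not a modulus of continuity).
* (U) `stub_ballClusterUnique` — UNIQUENESS OF THE CLUSTER POINT: any two locally-uniform limits of `F` along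
  positive null mesh sequences agree on `K_{R,n}` — the identification half (Duminil-Copin ICM 2022 §8.4: "proving
  that these scaling limits indeed exist"), with no mechanism in `d = 3` beyond subsequences.
* `BallLimits_of : (B) → (E) → (U) → BallLimits` — kernel-checked, sorry-free: an ASYMPTOTIC ARZELÀ–ASCOLI theorem
  for non-continuous (lattice step) functions (`Topology.exists_subseq_tendstoLocallyUniformlyOn`: countable dense
  set, diagonal extraction through Tychonoff + first countability of `ℝ^D` with clamping, uniform Cauchy on compacts
  via `cthickening` and finite nets, completeness, continuity of the limit from (E)) followed by the SUBSEQUENCE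
  PRINCIPLE for the countably generated filter `𝓝[>] 0` run in `X →ᵤ[𝔖] ℝ`, `𝔖` = compact subsets of `K`
  (`Topology.exists_tendstoLocallyUniformlyOn_of_bounded_equicont_unique`); then `K_{R,n}` is open and a choice
  over `n` assembles `S_R`. Its hypotheses are the stub statements BY NAME (`__Registered.stub_*`, `abbrev`s
  repeating the registered signatures verbatim — the form `#h21_check_skeleton` admits; device of the sibling
  skeletons `Cruxes/BallSpecifiedFieldLimit/Lines/birth.lean`, `Cruxes/PointwiseLimit/Lines/birth.lean`), and the
  closing `example` feeds it the registered stubs.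
* `stubs_of_BallLimits : BallLimits → (B) ∧ (E) ∧ (U)` and `BallLimits_iff_stubs` (sorry-free): exactness.

Disproof used: none — `Cruxes/BallLimits/` had no `Disproof.lean` and no `Negative/` lemma at registration
(`ledger crux ls stmt-CriticalPhenomena-5045`: no workfiles). Negatives index (`ledger negatives --problem
CriticalPhenomena`, 11 refuted statements, all on the Cardy/SAW/percolation conjuncts): no stub is an instance.

BC3 (registrar): `lean check` rc 0, sorries = 3 = stubs, zero elsewhere; probes `stub → BallLimits` and
`stub → Ising3DConformalLimit` by `first | exact? | simpa | aesop` FAIL for all three stubs (probe files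
`bc/probe_*.lean` in the registrar's folder; verdicts quoted in NOTES.md, `Lines/birth.md` and the evidence note).
-/

noncomputable section

namespace Summit.CriticalPhenomena.Ising3DConformalLimit.Cruxes.BallLimits.Birth

open scoped BigOperators Topology Classical UniformConvergence
open Filter Set

/-! ## Registered stubs

Conventions (those of the crux): the crux abbreviates by `let`s `G Ω δ n y := limUnder_{L→∞} ⟨∏ σ_{y_i}⟩⁺`, the
`+` b.c. critical correlation of the n.n. Ising model at `β_c(3)` in the lattice region `{z ∈ ℤ³ : δz ∈ Ω} ∩ box L`
(spins outside frozen `+`; for a bounded `Ω` the sequence is eventually constant, so `limUnder` is the finite-volume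
expectation), and `ρ δ := ⟨σ₀σ_{⌊1/δ⌋e₀}⟩_{β_c}^{-1/2}`, the canonical bulk renormalisation. In the stub signatures
below (and their `__Registered` aliases) these two abbreviations are WRITTEN OUT at `Ω = ball 0 R`: a registered
stub signature must be `let`-free (the registrar's signature scan ends a signature at its first `:=`), and the
written-out statements are the ζβ-reducts of the `let` forms, i.e. definitionally the crux's own expressions (the
composition below goes through `dsimp only`). `K_{R,n} = NonCoincident 3 n ∩ {x | ∀ i, x i ∈ ball 0 R}`;
configurations `Fin n → ℝ³` carry the sup metric. -/

/-- Registered stub `stub_ballHyperscalingBound` — **(B) eventual local boundedness of the `ρ_c`-renormalised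
`+` ball correlations (two-point hyperscaling in the ball).** For every `R > 0`, `n`, and compact
`K' ⊆ K_{R,n}` there is `M` with `|ρ_c(δ)ⁿ G_{B_R}^δ([x/δ])| ≤ M` for all `x ∈ K'` and all small `δ > 0`.
At `n = 1`: `⟨σ_{[x/δ]}⟩⁺_{B_{R/δ}} = O(⟨σ₀σ_{⌊1/δ⌋e₀}⟩^{1/2})` at macroscopic distance from the `+` sphere —
one-arm ≤ √two-point, OPEN on `ℤ³` (arXiv:2406.15243 §1.4, Open problem 1; Aizenman–Duminil-Copin–Sidoravicius
2015 give continuity, no rate). Necessary for the crux (`stubs_of_BallLimits`); its failure is the route's kill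
criterion (c). Size: open problem (L–XL).
[cite: arXiv:2406.15243, Open problem 1] [cite: AizenmanDuminilCopinSidoravicius2015, Thm 1.1] -/
theorem stub_ballHyperscalingBound :
    (∀ R : ℝ, 0 < R → ∀ n : ℕ, ∀ K ⊆ Literature.Probability.LatticeModels.NonCoincident 3 n ∩ {x | ∀ i, x i ∈ Metric.ball (0 : EuclideanSpace ℝ (Fin 3)) R}, IsCompact K → ∃ M : ℝ, ∀ᶠ δ in nhdsWithin (0:ℝ) (Set.Ioi 0), ∀ x ∈ K, |(1 / Real.sqrt (Literature.Probability.LatticeModels.criticalTwoPoint 3 (Pi.single 0 ⌊δ⁻¹⌋))) ^ n * Filter.limUnder Filter.atTop (fun L : ℕ => Literature.Probability.LatticeModels.isingExpect (Literature.Probability.LatticeModels.zdGraph 3) ((Literature.Probability.LatticeModels.box 3 L).filter (fun z => (WithLp.toLp 2 (fun i : Fin 3 => δ * (z i : ℝ)) : EuclideanSpace ℝ (Fin 3)) ∈ Metric.ball (0 : EuclideanSpace ℝ (Fin 3)) R)) (Literature.Probability.LatticeModels.criticalBeta 3) 0 Literature.Probability.LatticeModels.BoundaryCondition.plus (Literature.Probability.LatticeModels.spinMonomial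 (fun i => Literature.Probability.LatticeModels.latticeApprox δ (x i))))| ≤ M) := by
  sorry

/-- Registered stub `stub_ballEquicontinuity` — **(E) asymptotic equicontinuity of the `ρ_c`-renormalised
`+` ball correlations on compacts, uniform in the mesh.** For every `R > 0`, `n`, compact `K' ⊆ K_{R,n}` and
`ε > 0` there is a macroscopic `η > 0` such that for all small `δ > 0` and all `x, y ∈ K'` at sup-distance `< η`,
`|ρ_c(δ)ⁿ (G_{B_R}^δ([x/δ]) − G_{B_R}^δ([y/δ]))| < ε`. Macroscopic regularity of critical correlations
uniformly in `δ` — in 2D a by-product of RSW estimates / discrete holomorphicity (Chelkak–Hongler–Izyurov 2015,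
Thm 1.2); OPEN in 3D (no RSW theory on `ℤ³`; Messager–Miracle-Solé gives monotonicity along axes/diagonals only).
Necessary for the crux (`stubs_of_BallLimits`). Size: open problem (L–XL).
[cite: ChelkakHonglerIzyurov2015, Thm 1.2] [cite: MessagerMiracleSoleJSP1977, Thm 1] -/
theorem stub_ballEquicontinuity :
    (∀ R : ℝ, 0 < R → ∀ n : ℕ, ∀ K ⊆ Literature.Probability.LatticeModels.NonCoincident 3 n ∩ {x | ∀ i, x i ∈ Metric.ball (0 : EuclideanSpace ℝ (Fin 3)) R}, IsCompact K → ∀ ε : ℝ, 0 < ε → ∃ η : ℝ, 0 < η ∧ ∀ᶠ δ in nhdsWithin (0:ℝ) (Set.Ioi 0), ∀ x ∈ K, ∀ y ∈ K, dist x y < η → |(1 / Real.sqrt (Literature.Probability.LatticeModels.criticalTwoPoint 3 (Pi.single 0 ⌊δ⁻¹⌋))) ^ n * Filter.limUnder Filter.atTop (fun L : ℕ => Literature.Probability.LatticeModels.isingExpect (Literature.Probability.LatticeModels.zdGraph 3) ((Literature.Probability.LatticeModels.box 3 L).filter (fun z => (WithLp.toLp 2 (fun i : Fin 3 => δ * (z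 i : ℝ)) : EuclideanSpace ℝ (Fin 3)) ∈ Metric.ball (0 : EuclideanSpace ℝ (Fin 3)) R)) (Literature.Probability.LatticeModels.criticalBeta 3) 0 Literature.Probability.LatticeModels.BoundaryCondition.plus (Literature.Probability.LatticeModels.spinMonomial (fun i => Literature.Probability.LatticeModels.latticeApprox δ (x i)))) - (1 / Real.sqrt (Literature.Probability.LatticeModels.criticalTwoPoint 3 (Pi.single 0 ⌊δ⁻¹⌋))) ^ n * Filter.limUnder Filter.atTop (fun L : ℕ => Literature.Probability.LatticeModels.isingExpect (Literature.Probability.LatticeModels.zdGraph 3) ((Literature.Probability.LatticeModels.box 3 L).filter (fun z => (WithLp.toLp 2 (fun i : Fin 3 => δ * (z i : ℝ)) : EuclideanSpace ℝ (Fin 3)) ∈ Metric.ball (0 : EuclideanSpace ℝ (Fin 3)) R)) (Literature.Probability.LatticeModels.criticalBeta 3) 0 Literature.Probability.LatticeModels.BoundaryCondition.plus (Literature.Probability.LatticeModels.spinMonomial (fun i => Literature.Probability.LatticeModels.latticeApprox δ (y i))))| < ε) := by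
  sorry

/-- Registered stub `stub_ballClusterUnique` — **(U) uniqueness of the cluster point of the `ρ_c`-renormalised
`+` ball correlations.** For every `R > 0` and `n`: if along two mesh sequences `u_k, u'_k > 0`, `u_k, u'_k → 0`,
the renormalised ball correlations converge locally uniformly on `K_{R,n}` to `g` resp. `g'`, then `g = g'` on
`K_{R,n}`. The identification half of the existence of the critical scaling limit (Duminil-Copin, ICM 2022,
§8.4), with no mechanism in `d = 3` beyond subsequences; vacuous along scales where tightness fails, so it is
NOT the crux. Necessary for the crux (`stubs_of_BallLimits`). Size: open problem (XL; the hardest stub).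
[cite: DuminilCopinICM2022, §8.4] [cite: ChelkakHonglerIzyurov2015, Thm 1.2] -/
theorem stub_ballClusterUnique :
    (∀ R : ℝ, 0 < R → ∀ n : ℕ, ∀ (u u' : ℕ → ℝ) (g g' : (Fin n → EuclideanSpace ℝ (Fin 3)) → ℝ), (∀ k, 0 < u k) → Filter.Tendsto u Filter.atTop (nhds 0) → (∀ k, 0 < u' k) → Filter.Tendsto u' Filter.atTop (nhds 0) → TendstoLocallyUniformlyOn (fun k x => (1 / Real.sqrt (Literature.Probability.LatticeModels.criticalTwoPoint 3 (Pi.single 0 ⌊(u k)⁻¹⌋))) ^ n * Filter.limUnder Filter.atTop (fun L : ℕ => Literature.Probability.LatticeModels.isingExpect (Literature.Probability.LatticeModels.zdGraph 3) ((Literature.Probability.LatticeModels.box 3 L).filter (fun z => (WithLp.toLp 2 (fun i : Fin 3 => u k * (z i : ℝ)) : EuclideanSpace ℝ (Fin 3)) ∈ Metric.ball (0 : EuclideanSpace ℝ (Fin 3)) R)) (Literature.Probability.LatticeModels.criticalBeta 3) 0 Literature.Probability.LatticeModels.BoundaryCondition.plus (Literature.Probability.LatticeModels.spinMonomial (fun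 i => Literature.Probability.LatticeModels.latticeApprox (u k) (x i))))) g Filter.atTop (Literature.Probability.LatticeModels.NonCoincident 3 n ∩ {x | ∀ i, x i ∈ Metric.ball (0 : EuclideanSpace ℝ (Fin 3)) R}) → TendstoLocallyUniformlyOn (fun k x => (1 / Real.sqrt (Literature.Probability.LatticeModels.criticalTwoPoint 3 (Pi.single 0 ⌊(u' k)⁻¹⌋))) ^ n * Filter.limUnder Filter.atTop (fun L : ℕ => Literature.Probability.LatticeModels.isingExpect (Literature.Probability.LatticeModels.zdGraph 3) ((Literature.Probability.LatticeModels.box 3 L).filter (fun z => (WithLp.toLp 2 (fun i : Fin 3 => u' k * (z i : ℝ)) : EuclideanSpace ℝ (Fin 3)) ∈ Metric.ball (0 : EuclideanSpace ℝ (Fin 3)) R)) (Literature.Probability.LatticeModels.criticalBeta 3) 0 Literature.Probability.LatticeModels.BoundaryCondition.plus (Literature.Probability.LatticeModels.spinMonomial (fun i => Literature.Probability.LatticeModels.latticeApprox (u' k) (x i))))) g' Filter.atTop (Literature.Probability.LatticeModels.NonCoincident 3 n ∩ {x | ∀ i, x i ∈ Metric.ball (0 : EuclideanSpace ℝ (Fin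 3)) R}) → Set.EqOn g g' (Literature.Probability.LatticeModels.NonCoincident 3 n ∩ {x | ∀ i, x i ∈ Metric.ball (0 : EuclideanSpace ℝ (Fin 3)) R})) := by
  sorry

/-! ### The three stub statements BY NAME — the hypotheses of `BallLimits_of`

The native skeleton audit (`#h21_check_skeleton`, run by `ledger skeleton check`) admits a hypothesis of the
composing theorem only if its head constant is a registered obligation or is NAMED like a declared stub; so each
registered stub `stub_X : <signature> := by sorry` above is mirrored by the alias
`abbrev __Registered.stub_X : Prop := <the same signature, verbatim>` and `BallLimits_of` is stated over the three
aliases (the gate-reserved `@[stub]` attribute is not written by a planner). Each alias is an `abbrev`,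
definitionally its statement; the `example` after the composition instantiates it with the registered stubs. -/
namespace __Registered

/-- Alias of the statement of the registered stub `stub_ballHyperscalingBound` (B), keyed by its name. -/
abbrev stub_ballHyperscalingBound : Prop :=
    (∀ R : ℝ, 0 < R → ∀ n : ℕ, ∀ K ⊆ Literature.Probability.LatticeModels.NonCoincident 3 n ∩ {x | ∀ i, x i ∈ Metric.ball (0 : EuclideanSpace ℝ (Fin 3)) R}, IsCompact K → ∃ M : ℝ, ∀ᶠ δ in nhdsWithin (0:ℝ) (Set.Ioi 0), ∀ x ∈ K, |(1 / Real.sqrt (Literature.Probability.LatticeModels.criticalTwoPoint 3 (Pi.single 0 ⌊δ⁻¹⌋))) ^ n * Filter.limUnder Filter.atTop (fun L : ℕ => Literature.Probability.LatticeModels.isingExpect (Literature.Probability.LatticeModels.zdGraph 3) ((Literature.Probability.LatticeModels.box 3 L).filter (fun z => (WithLp.toLp 2 (fun i : Fin 3 => δ * (z i : ℝ)) : EuclideanSpace ℝ (Fin 3)) ∈ Metric.ball (0 : EuclideanSpace ℝ (Fin 3)) R)) (Literature.Probability.LatticeModels.criticalBeta 3) 0 Literature.Probability.LatticeModels.BoundaryCondition.plus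 (Literature.Probability.LatticeModels.spinMonomial (fun i => Literature.Probability.LatticeModels.latticeApprox δ (x i))))| ≤ M)

/-- Alias of the statement of the registered stub `stub_ballEquicontinuity` (E), keyed by its name. -/
abbrev stub_ballEquicontinuity : Prop :=
    (∀ R : ℝ, 0 < R → ∀ n : ℕ, ∀ K ⊆ Literature.Probability.LatticeModels.NonCoincident 3 n ∩ {x | ∀ i, x i ∈ Metric.ball (0 : EuclideanSpace ℝ (Fin 3)) R}, IsCompact K → ∀ ε : ℝ, 0 < ε → ∃ η : ℝ, 0 < η ∧ ∀ᶠ δ in nhdsWithin (0:ℝ) (Set.Ioi 0), ∀ x ∈ K, ∀ y ∈ K, dist x y < η → |(1 / Real.sqrt (Literature.Probability.LatticeModels.criticalTwoPoint 3 (Pi.single 0 ⌊δ⁻¹⌋))) ^ n * Filter.limUnder Filter.atTop (fun L : ℕ => Literature.Probability.LatticeModels.isingExpect (Literature.Probability.LatticeModels.zdGraph 3) ((Literature.Probability.LatticeModels.box 3 L).filter (fun z => (WithLp.toLp 2 (fun i : Fin 3 => δ * (z i : ℝ)) : EuclideanSpace ℝ (Fin 3)) ∈ Metric.ball (0 : EuclideanSpace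 ℝ (Fin 3)) R)) (Literature.Probability.LatticeModels.criticalBeta 3) 0 Literature.Probability.LatticeModels.BoundaryCondition.plus (Literature.Probability.LatticeModels.spinMonomial (fun i => Literature.Probability.LatticeModels.latticeApprox δ (x i)))) - (1 / Real.sqrt (Literature.Probability.LatticeModels.criticalTwoPoint 3 (Pi.single 0 ⌊δ⁻¹⌋))) ^ n * Filter.limUnder Filter.atTop (fun L : ℕ => Literature.Probability.LatticeModels.isingExpect (Literature.Probability.LatticeModels.zdGraph 3) ((Literature.Probability.LatticeModels.box 3 L).filter (fun z => (WithLp.toLp 2 (fun i : Fin 3 => δ * (z i : ℝ)) : EuclideanSpace ℝ (Fin 3)) ∈ Metric.ball (0 : EuclideanSpace ℝ (Fin 3)) R)) (Literature.Probability.LatticeModels.criticalBeta 3) 0 Literature.Probability.LatticeModels.BoundaryCondition.plus (Literature.Probability.LatticeModels.spinMonomial (fun i => Literature.Probability.LatticeModels.latticeApprox δ (y i))))| < ε)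

/-- Alias of the statement of the registered stub `stub_ballClusterUnique` (U), keyed by its name. -/
abbrev stub_ballClusterUnique : Prop :=
    (∀ R : ℝ, 0 < R → ∀ n : ℕ, ∀ (u u' : ℕ → ℝ) (g g' : (Fin n → EuclideanSpace ℝ (Fin 3)) → ℝ), (∀ k, 0 < u k) → Filter.Tendsto u Filter.atTop (nhds 0) → (∀ k, 0 < u' k) → Filter.Tendsto u' Filter.atTop (nhds 0) → TendstoLocallyUniformlyOn (fun k x => (1 / Real.sqrt (Literature.Probability.LatticeModels.criticalTwoPoint 3 (Pi.single 0 ⌊(u k)⁻¹⌋))) ^ n * Filter.limUnder Filter.atTop (fun L : ℕ => Literature.Probability.LatticeModels.isingExpect (Literature.Probability.LatticeModels.zdGraph 3) ((Literature.Probability.LatticeModels.box 3 L).filter (fun z => (WithLp.toLp 2 (fun i : Fin 3 => u k * (z i : ℝ)) : EuclideanSpace ℝ (Fin 3)) ∈ Metric.ball (0 : EuclideanSpace ℝ (Fin 3)) R)) (Literature.Probability.LatticeModels.criticalBeta 3) 0 Literature.Probability.LatticeModels.BoundaryCondition.plus (Literature.Probability.LatticeModels.spinMonomial (fun i => Literature.Probability.LatticeModels.latticeApprox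 (u k) (x i))))) g Filter.atTop (Literature.Probability.LatticeModels.NonCoincident 3 n ∩ {x | ∀ i, x i ∈ Metric.ball (0 : EuclideanSpace ℝ (Fin 3)) R}) → TendstoLocallyUniformlyOn (fun k x => (1 / Real.sqrt (Literature.Probability.LatticeModels.criticalTwoPoint 3 (Pi.single 0 ⌊(u' k)⁻¹⌋))) ^ n * Filter.limUnder Filter.atTop (fun L : ℕ => Literature.Probability.LatticeModels.isingExpect (Literature.Probability.LatticeModels.zdGraph 3) ((Literature.Probability.LatticeModels.box 3 L).filter (fun z => (WithLp.toLp 2 (fun i : Fin 3 => u' k * (z i : ℝ)) : EuclideanSpace ℝ (Fin 3)) ∈ Metric.ball (0 : EuclideanSpace ℝ (Fin 3)) R)) (Literature.Probability.LatticeModels.criticalBeta 3) 0 Literature.Probability.LatticeModels.BoundaryCondition.plus (Literature.Probability.LatticeModels.spinMonomial (fun i => Literature.Probability.LatticeModels.latticeApprox (u' k) (x i))))) g' Filter.atTop (Literature.Probability.LatticeModels.NonCoincident 3 n ∩ {x | ∀ i, x i ∈ Metric.ball (0 : EuclideanSpace ℝ (Fin 3)) R}) → Set.EqOn g g' (Literature.Probability.LatticeModels.NonCoincident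 3 n ∩ {x | ∀ i, x i ∈ Metric.ball (0 : EuclideanSpace ℝ (Fin 3)) R}))

end __Registered

/-! ## The glue, proved: asymptotic Arzelà–Ascoli and the subsequence principle

Pure topology/analysis on a proper metric space `X` (here `X = (Fin n → ℝ³)` with the sup metric) and an open
`K ⊆ X`; nothing Ising-specific. Sorry-free; axioms `propext`, `Classical.choice`, `Quot.sound`. -/
namespace Topology

open Metric

theorem clamp_eq {C v : ℝ} (h : |v| ≤ C) : max (-C) (min C v) = v := by
  have h1 : v ≤ C := (le_abs_self v).trans h
  have h2 : -C ≤ v := by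
    have := neg_abs_le v
    linarith
  rw [min_eq_right h1, max_eq_right h2]

theorem clamp_mem {C : ℝ} (v : ℝ) (hC : 0 ≤ C) : max (-C) (min C v) ∈ Icc (-C) C :=
  ⟨le_max_left _ _, max_le (by linarith) (min_le_left _ _)⟩

/-- **Diagonal extraction.** A sequence of real functions, eventually bounded at each point of a countable
set `D`, has a subsequence converging at every point of `D` (Tychonoff on `∏_{d ∈ D} [-M_d, M_d]`, which is
first countable, applied to the clamped sequence; the clamp is eventually inactive). -/
theorem exists_subseq_forall_tendsto {X : Type*} {D : Set X} (hD : D.Countable) (f : ℕ → X → ℝ)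
    (hb : ∀ d ∈ D, ∃ M : ℝ, ∀ᶠ k in atTop, |f k d| ≤ M) :
    ∃ φ : ℕ → ℕ, StrictMono φ ∧ ∀ d ∈ D, ∃ a : ℝ, Tendsto (fun k => f (φ k) d) atTop (𝓝 a) := by
  classical
  haveI : Countable D := hD.to_subtype
  choose! M hM using hb
  let Ψ : ℕ → (D → ℝ) := fun k d => max (-|M d|) (min |M d| (f k d))
  have hΨ : ∀ k, Ψ k ∈ Set.pi Set.univ (fun d : D => Icc (-|M (d : X)|) |M (d : X)|) :=
    fun k d _ => clamp_mem _ (abs_nonneg _)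
  have hcpt : IsCompact (Set.pi Set.univ (fun d : D => Icc (-|M (d : X)|) |M (d : X)|)) :=
    isCompact_univ_pi fun _ => isCompact_Icc
  obtain ⟨a, -, φ, hφ, hlim⟩ := hcpt.isSeqCompact hΨ
  refine ⟨φ, hφ, fun d hd => ⟨a ⟨d, hd⟩, ?_⟩⟩
  have h1 : Tendsto (fun k => (Ψ ∘ φ) k ⟨d, hd⟩) atTop (𝓝 (a ⟨d, hd⟩)) :=
    tendsto_pi_nhds.1 hlim ⟨d, hd⟩
  refine h1.congr' ?_
  have h2 : ∀ᶠ k in atTop, |f (φ k) d| ≤ M d := hφ.tendsto_atTop.eventually (hM d hd)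
  filter_upwards [h2] with k hk
  show max (-|M d|) (min |M d| (f (φ k) d)) = f (φ k) d
  exact clamp_eq (hk.trans (le_abs_self _))

variable {X : Type*} [MetricSpace X] [ProperSpace X]

/-- **Uniform Cauchy on compacts** from pointwise Cauchy on a dense subset of the open set `K` plus asymptotic
equicontinuity on the compact subsets of `K` (finite `η`-net inside a compact `cthickening` of `K'`). -/
theorem uniformCauchySeqOn_of_asympEquicont {K K' D : Set X} (hK : IsOpen K)
    (hK'K : K' ⊆ K) (hK' : IsCompact K') (hDK : K ⊆ closure D) (g : ℕ → X → ℝ)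
    (hE : ∀ K'' ⊆ K, IsCompact K'' → ∀ ε : ℝ, 0 < ε → ∃ η : ℝ, 0 < η ∧ ∀ᶠ k in atTop,
      ∀ x ∈ K'', ∀ y ∈ K'', dist x y < η → dist (g k x) (g k y) < ε)
    (hD : ∀ d ∈ D, CauchySeq (fun k => g k d)) :
    UniformCauchySeqOn g atTop K' := by
  rw [Metric.uniformCauchySeqOn_iff]
  intro ε hε
  obtain ⟨η₀, hη₀, hthick⟩ := hK'.exists_cthickening_subset_open hK hK'K
  have hK''c : IsCompact (cthickening η₀ K') := hK'.cthickening
  have hK'K'' : K' ⊆ cthickening η₀ K' := self_subset_cthickening K'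
  have hε3 : (0 : ℝ) < ε / 3 := by positivity
  obtain ⟨η, hη, hev⟩ := hE _ hthick hK''c (ε / 3) hε3
  have hη' : 0 < min η η₀ := lt_min hη hη₀
  have hcover : K' ⊆ ⋃ d : ↥(D ∩ cthickening η₀ K'), ball (d : X) (min η η₀) := by
    intro x hx
    obtain ⟨d, hdD, hxd⟩ := Metric.mem_closure_iff.1 (hDK (hK'K hx)) (min η η₀) hη'
    have hdK'' : d ∈ cthickening η₀ K' := by
      refine mem_cthickening_of_dist_le d x η₀ K' hx ?_
      rw [dist_comm]
      exact (hxd.trans_le (min_le_right _ _)).le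
    exact mem_iUnion.2 ⟨⟨d, hdD, hdK''⟩, mem_ball.2 hxd⟩
  obtain ⟨t, ht⟩ := hK'.elim_finite_subcover _ (fun _ => isOpen_ball) hcover
  have hnet : ∀ᶠ N in atTop, ∀ d ∈ t, ∀ m ≥ N, ∀ n ≥ N,
      dist (g m (d : X)) (g n (d : X)) < ε / 3 := by
    refine (eventually_all_finset t).2 fun d _ => ?_
    obtain ⟨N, hN⟩ := Metric.cauchySeq_iff.1 (hD (d : X) d.2.1) (ε / 3) hε3
    exact eventually_atTop.2 ⟨N, fun N' hN' m hm n hn => hN m (hN'.trans hm) n (hN'.trans hn)⟩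
  have hev' : ∀ᶠ N in atTop, ∀ k ≥ N, ∀ x ∈ cthickening η₀ K', ∀ y ∈ cthickening η₀ K',
      dist x y < η → dist (g k x) (g k y) < ε / 3 := by
    obtain ⟨N, hN⟩ := eventually_atTop.1 hev
    exact eventually_atTop.2 ⟨N, fun N' hN' k hk => hN k (hN'.trans hk)⟩
  obtain ⟨N, hN1, hN2⟩ := (hnet.and hev').exists
  refine ⟨N, fun m hm n hn x hx => ?_⟩
  have hx' := ht hx
  simp only [mem_iUnion, exists_prop] at hx'
  obtain ⟨d, hdt, hxd⟩ := hx'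
  have hxd' : dist x (d : X) < η := (mem_ball.1 hxd).trans_le (min_le_left _ _)
  have h1 := hN2 m hm x (hK'K'' hx) d d.2.2 hxd'
  have h2 := hN1 d hdt m hm n hn
  have h3 := hN2 n hn x (hK'K'' hx) d d.2.2 hxd'
  rw [dist_comm] at h3
  calc dist (g m x) (g n x)
      ≤ dist (g m x) (g m d) + dist (g m (d : X)) (g n d) + dist (g n (d : X)) (g n x) :=
        dist_triangle4 _ _ _ _
    _ < ε / 3 + ε / 3 + ε / 3 := by linarith
    _ = ε := by ring

/-- **Asymptotic Arzelà–Ascoli** (for arbitrary, e.g. lattice step, functions). A sequence of real functions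
which is eventually bounded on every compact subset of the open set `K` and asymptotically equicontinuous there
has a subsequence converging locally uniformly on `K` to a limit continuous on `K`. -/
theorem exists_subseq_tendstoLocallyUniformlyOn {K : Set X} (hK : IsOpen K) (f : ℕ → X → ℝ)
    (hB : ∀ K' ⊆ K, IsCompact K' → ∃ M : ℝ, ∀ᶠ k in atTop, ∀ x ∈ K', |f k x| ≤ M)
    (hE : ∀ K' ⊆ K, IsCompact K' → ∀ ε : ℝ, 0 < ε → ∃ η : ℝ, 0 < η ∧ ∀ᶠ k in atTop,
      ∀ x ∈ K', ∀ y ∈ K', dist x y < η → dist (f k x) (f k y) < ε) :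
    ∃ φ : ℕ → ℕ, StrictMono φ ∧ ∃ g : X → ℝ, ContinuousOn g K ∧
      TendstoLocallyUniformlyOn (fun k => f (φ k)) g atTop K := by
  classical
  obtain ⟨D₀, hD₀c, hD₀d⟩ := TopologicalSpace.exists_countable_dense X
  have hDc : (K ∩ D₀).Countable := hD₀c.mono inter_subset_right
  have hDK : K ⊆ closure (K ∩ D₀) := hD₀d.open_subset_closure_inter hK
  have hDsub : K ∩ D₀ ⊆ K := inter_subset_left
  have hb : ∀ d ∈ K ∩ D₀, ∃ M : ℝ, ∀ᶠ k in atTop, |f k d| ≤ M := by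
    intro d hd
    obtain ⟨M, hM⟩ := hB {d} (singleton_subset_iff.2 (hDsub hd)) isCompact_singleton
    exact ⟨M, hM.mono fun k hk => hk d (mem_singleton d)⟩
  obtain ⟨φ, hφ, hconvD⟩ := exists_subseq_forall_tendsto hDc f hb
  have hE' : ∀ K' ⊆ K, IsCompact K' → ∀ ε : ℝ, 0 < ε → ∃ η : ℝ, 0 < η ∧ ∀ᶠ k in atTop,
      ∀ x ∈ K', ∀ y ∈ K', dist x y < η → dist (f (φ k) x) (f (φ k) y) < ε := by
    intro K' hK'K hK' ε hε
    obtain ⟨η, hη, hev⟩ := hE K' hK'K hK' ε hε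
    exact ⟨η, hη, hφ.tendsto_atTop.eventually hev⟩
  have hDcauchy : ∀ d ∈ K ∩ D₀, CauchySeq (fun k => f (φ k) d) := fun d hd =>
    (hconvD d hd).choose_spec.cauchySeq
  have hUC : ∀ K' ⊆ K, IsCompact K' → UniformCauchySeqOn (fun k => f (φ k)) atTop K' :=
    fun K' hK'K hK' =>
      uniformCauchySeqOn_of_asympEquicont hK hK'K hK' hDK (fun k => f (φ k)) hE' hDcauchy
  have hpt : ∀ x ∈ K, CauchySeq (fun k => f (φ k) x) := by
    intro x hx
    have h := hUC {x} (singleton_subset_iff.2 hx) isCompact_singleton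
    exact h.cauchy_map (mem_singleton x)
  refine ⟨φ, hφ, fun x => limUnder atTop (fun k => f (φ k) x), ?_, ?_⟩
  · -- continuity of the limit on `K`, from (E) passed to the limit
    have hgx : ∀ x ∈ K, Tendsto (fun k => f (φ k) x) atTop
        (𝓝 (limUnder atTop (fun k => f (φ k) x))) := fun x hx => (hpt x hx).tendsto_limUnder
    rw [Metric.continuousOn_iff]
    intro x₀ hx₀ ε hε
    obtain ⟨r, hr, hball⟩ := Metric.isOpen_iff.1 hK x₀ hx₀
    have hcb : closedBall x₀ (r / 2) ⊆ K := (closedBall_subset_ball (by linarith)).trans hball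
    obtain ⟨η, hη, hev⟩ :=
      hE' (closedBall x₀ (r / 2)) hcb (isCompact_closedBall _ _) (ε / 2) (by positivity)
    refine ⟨min η (r / 2), lt_min hη (by positivity), fun y hy hyx => ?_⟩
    have hy' : y ∈ closedBall x₀ (r / 2) :=
      mem_closedBall.2 (hyx.trans_le (min_le_right _ _)).le
    have hx₀' : x₀ ∈ closedBall x₀ (r / 2) := mem_closedBall_self (by positivity)
    have hlim := (hgx y hy).dist (hgx x₀ hx₀)
    have hle : dist (limUnder atTop (fun k => f (φ k) y)) (limUnder atTop (fun k => f (φ k) x₀))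
        ≤ ε / 2 :=
      le_of_tendsto hlim
        (hev.mono fun k hk => (hk y hy' x₀ hx₀' (hyx.trans_le (min_le_left _ _))).le)
    linarith
  · refine (tendstoLocallyUniformlyOn_iff_forall_isCompact hK).2 fun K' hK'K hK' => ?_
    exact (hUC K' hK'K hK').tendstoUniformlyOn_of_tendsto fun x hx =>
      (hpt x (hK'K hx)).tendsto_limUnder

/-- **(B) ∧ (E) ∧ (U) ⇒ full-filter locally uniform convergence to a continuous limit.** Asymptotic
Arzelà–Ascoli along every positive null sequence, uniqueness of the cluster point, and the subsequence
principle (`Filter.tendsto_of_subseq_tendsto`) for the countably generated filter `𝓝[>] 0`, run in the space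
`X →ᵤ[𝔖] ℝ` of functions with the topology of uniform convergence on `𝔖` = the compact subsets of `K`. -/
theorem exists_tendstoLocallyUniformlyOn_of_bounded_equicont_unique {K : Set X}
    (hK : IsOpen K) (F : ℝ → X → ℝ)
    (hB : ∀ K' ⊆ K, IsCompact K' → ∃ M : ℝ, ∀ᶠ δ in 𝓝[>] (0 : ℝ), ∀ x ∈ K', |F δ x| ≤ M)
    (hE : ∀ K' ⊆ K, IsCompact K' → ∀ ε : ℝ, 0 < ε → ∃ η : ℝ, 0 < η ∧ ∀ᶠ δ in 𝓝[>] (0 : ℝ),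
      ∀ x ∈ K', ∀ y ∈ K', dist x y < η → |F δ x - F δ y| < ε)
    (hU : ∀ (u u' : ℕ → ℝ) (g g' : X → ℝ), (∀ k, 0 < u k) → Tendsto u atTop (𝓝 0) →
      (∀ k, 0 < u' k) → Tendsto u' atTop (𝓝 0) →
      TendstoLocallyUniformlyOn (fun k => F (u k)) g atTop K →
      TendstoLocallyUniformlyOn (fun k => F (u' k)) g' atTop K → EqOn g g' K) :
    ∃ g : X → ℝ, TendstoLocallyUniformlyOn F g (𝓝[>] (0 : ℝ)) K ∧ ContinuousOn g K := by
  classical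
  -- (T) along every positive null sequence, from (B) and (E)
  have hT : ∀ u : ℕ → ℝ, (∀ k, 0 < u k) → Tendsto u atTop (𝓝 0) →
      ∃ φ : ℕ → ℕ, StrictMono φ ∧ ∃ g : X → ℝ, ContinuousOn g K ∧
        TendstoLocallyUniformlyOn (fun k => F (u (φ k))) g atTop K := by
    intro u hpos hu
    have hu' : Tendsto u atTop (𝓝[>] (0 : ℝ)) :=
      tendsto_nhdsWithin_iff.2 ⟨hu, Eventually.of_forall hpos⟩
    refine exists_subseq_tendstoLocallyUniformlyOn hK (fun k => F (u k)) ?_ ?_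
    · intro K' hK'K hK'
      obtain ⟨M, hM⟩ := hB K' hK'K hK'
      exact ⟨M, hu'.eventually hM⟩
    · intro K' hK'K hK' ε hε
      obtain ⟨η, hη, hev⟩ := hE K' hK'K hK' ε hε
      refine ⟨η, hη, (hu'.eventually hev).mono fun k hk x hx y hy hxy => ?_⟩
      rw [Real.dist_eq]
      exact hk x hx y hy hxy
  -- the reference cluster point, along `δ_k = 1/(k+1)`
  have hu₀pos : ∀ k : ℕ, (0 : ℝ) < 1 / ((k : ℝ) + 1) := fun k => by positivity
  have hu₀lim : Tendsto (fun k : ℕ => 1 / ((k : ℝ) + 1)) atTop (𝓝 0) :=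
    tendsto_one_div_add_atTop_nhds_zero_nat
  obtain ⟨φ₀, hφ₀, g₀, hg₀, hconv₀⟩ := hT (fun k : ℕ => 1 / ((k : ℝ) + 1)) hu₀pos hu₀lim
  refine ⟨g₀, ?_, hg₀⟩
  have key : Tendsto (fun δ => UniformOnFun.ofFun {K' : Set X | K' ⊆ K ∧ IsCompact K'} (F δ))
      (𝓝[>] (0 : ℝ)) (𝓝 (UniformOnFun.ofFun {K' : Set X | K' ⊆ K ∧ IsCompact K'} g₀)) := by
    refine Filter.tendsto_of_subseq_tendsto fun ns hns => ?_
    obtain ⟨hns0, hnspos⟩ := tendsto_nhdsWithin_iff.1 hns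
    obtain ⟨k₀, hk₀⟩ := eventually_atTop.1 hnspos
    have hupos : ∀ k, 0 < ns (k + k₀) := fun k => hk₀ (k + k₀) (Nat.le_add_left k₀ k)
    have hulim : Tendsto (fun k => ns (k + k₀)) atTop (𝓝 0) := hns0.comp (tendsto_add_atTop_nat k₀)
    obtain ⟨φ, hφ, g, -, hconv⟩ := hT (fun k => ns (k + k₀)) hupos hulim
    have heq : EqOn g g₀ K :=
      hU (fun k => ns (φ k + k₀)) (fun k => 1 / (((φ₀ k : ℕ) : ℝ) + 1)) g g₀ (fun k => hupos _)
        (hulim.comp hφ.tendsto_atTop) (fun k => hu₀pos _) (hu₀lim.comp hφ₀.tendsto_atTop)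
        hconv hconv₀
    refine ⟨fun k => φ k + k₀, ?_⟩
    rw [UniformOnFun.tendsto_iff_tendstoUniformlyOn]
    intro K' hK'
    have h1 : TendstoUniformlyOn (fun k => F (ns (φ k + k₀))) g atTop K' :=
      (tendstoLocallyUniformlyOn_iff_forall_isCompact hK).1 hconv K' hK'.1 hK'.2
    have h2 : TendstoUniformlyOn (fun k => F (ns (φ k + k₀))) g₀ atTop K' :=
      h1.congr_right (heq.mono hK'.1)
    simpa [Function.comp_def, UniformOnFun.toFun_ofFun] using h2
  rw [tendstoLocallyUniformlyOn_iff_forall_isCompact hK]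
  intro K' hK'K hK'
  have := (UniformOnFun.tendsto_iff_tendstoUniformlyOn.1 key) K' ⟨hK'K, hK'⟩
  simpa [Function.comp_def, UniformOnFun.toFun_ofFun] using this

/-! ### Converses (the crux implies each stub): exactness of the decomposition -/

omit [ProperSpace X] in
/-- A locally uniform limit with continuous limit function is eventually bounded on compacts. -/
theorem eventually_bounded_of_tendstoLocallyUniformlyOn [LocallyCompactSpace X] {ι : Type*}
    {p : Filter ι} {K : Set X} (hK : IsOpen K) {F : ι → X → ℝ} {g : X → ℝ}
    (h : TendstoLocallyUniformlyOn F g p K) (hg : ContinuousOn g K) :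
    ∀ K' ⊆ K, IsCompact K' → ∃ M : ℝ, ∀ᶠ i in p, ∀ x ∈ K', |F i x| ≤ M := by
  intro K' hK'K hK'
  have hu := (tendstoLocallyUniformlyOn_iff_forall_isCompact hK).1 h K' hK'K hK'
  obtain ⟨C, hC⟩ := hK'.exists_bound_of_continuousOn (hg.mono hK'K)
  refine ⟨C + 1, ?_⟩
  filter_upwards [(Metric.tendstoUniformlyOn_iff.1 hu) 1 one_pos] with i hi x hx
  have h1 : dist (g x) (F i x) < 1 := hi x hx
  have h2 : ‖g x‖ ≤ C := hC x hx
  rw [Real.dist_eq] at h1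
  rw [Real.norm_eq_abs] at h2
  calc |F i x| = |g x - (g x - F i x)| := by congr 1; ring
    _ ≤ |g x| + |g x - F i x| := abs_sub _ _
    _ ≤ C + 1 := by linarith

omit [ProperSpace X] in
/-- A locally uniform limit with continuous limit function is asymptotically equicontinuous on compacts. -/
theorem asympEquicont_of_tendstoLocallyUniformlyOn [LocallyCompactSpace X] {ι : Type*}
    {p : Filter ι} {K : Set X} (hK : IsOpen K) {F : ι → X → ℝ} {g : X → ℝ}
    (h : TendstoLocallyUniformlyOn F g p K) (hg : ContinuousOn g K) :
    ∀ K' ⊆ K, IsCompact K' → ∀ ε : ℝ, 0 < ε → ∃ η : ℝ, 0 < η ∧ ∀ᶠ i in p,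
      ∀ x ∈ K', ∀ y ∈ K', dist x y < η → |F i x - F i y| < ε := by
  intro K' hK'K hK' ε hε
  have hu := (tendstoLocallyUniformlyOn_iff_forall_isCompact hK).1 h K' hK'K hK'
  have huc : UniformContinuousOn g K' := hK'.uniformContinuousOn_of_continuous (hg.mono hK'K)
  obtain ⟨η, hη, hηuc⟩ := Metric.uniformContinuousOn_iff.1 huc (ε / 3) (by positivity)
  refine ⟨η, hη, ?_⟩
  filter_upwards [(Metric.tendstoUniformlyOn_iff.1 hu) (ε / 3) (by positivity)] with i hi x hx y hy hxy
  have h1 : dist (g x) (F i x) < ε / 3 := hi x hx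
  have h2 : dist (g y) (F i y) < ε / 3 := hi y hy
  have h3 : dist (g x) (g y) < ε / 3 := hηuc x hx y hy hxy
  rw [Real.dist_eq] at h1 h2 h3
  calc |F i x - F i y| = |(g y - F i y) - (g x - F i x) + (g x - g y)| := by congr 1; ring
    _ ≤ |(g y - F i y) - (g x - F i x)| + |g x - g y| := abs_add_le _ _
    _ ≤ |g y - F i y| + |g x - F i x| + |g x - g y| := by
        have := abs_sub (g y - F i y) (g x - F i x)
        linarith
    _ < ε / 3 + ε / 3 + ε / 3 := by linarith
    _ = ε := by ring

omit [ProperSpace X] in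
/-- A full-filter locally uniform limit along `𝓝[>] 0` determines every sequential cluster point. -/
theorem clusterUnique_of_tendstoLocallyUniformlyOn {K : Set X} {F : ℝ → X → ℝ} {S : X → ℝ}
    (h : TendstoLocallyUniformlyOn F S (𝓝[>] (0 : ℝ)) K) :
    ∀ (u u' : ℕ → ℝ) (g g' : X → ℝ), (∀ k, 0 < u k) → Tendsto u atTop (𝓝 0) →
      (∀ k, 0 < u' k) → Tendsto u' atTop (𝓝 0) →
      TendstoLocallyUniformlyOn (fun k => F (u k)) g atTop K →
      TendstoLocallyUniformlyOn (fun k => F (u' k)) g' atTop K → EqOn g g' K := by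
  intro u u' g g' hu hu0 hu' hu'0 hg hg' x hx
  have hut : Tendsto u atTop (𝓝[>] (0 : ℝ)) :=
    tendsto_nhdsWithin_iff.2 ⟨hu0, Eventually.of_forall hu⟩
  have hut' : Tendsto u' atTop (𝓝[>] (0 : ℝ)) :=
    tendsto_nhdsWithin_iff.2 ⟨hu'0, Eventually.of_forall hu'⟩
  have h1 : Tendsto (fun k => F (u k) x) atTop (𝓝 (S x)) := (h.tendsto_at hx).comp hut
  have h2 : Tendsto (fun k => F (u k) x) atTop (𝓝 (g x)) := hg.tendsto_at hx
  have h3 : Tendsto (fun k => F (u' k) x) atTop (𝓝 (S x)) := (h.tendsto_at hx).comp hut'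
  have h4 : Tendsto (fun k => F (u' k) x) atTop (𝓝 (g' x)) := hg'.tendsto_at hx
  exact (tendsto_nhds_unique h2 h1).trans (tendsto_nhds_unique h3 h4)

end Topology

/-! ## Composition — the crux BY NAME -/

/-- The configuration domain `K_{R,n} = NonCoincident 3 n ∩ (B_R)ⁿ` is open. -/
theorem isOpen_ballConfig (R : ℝ) (n : ℕ) :
    IsOpen (Literature.Probability.LatticeModels.NonCoincident 3 n ∩
      {x : Fin n → EuclideanSpace ℝ (Fin 3) | ∀ i, x i ∈ Metric.ball (0 : EuclideanSpace ℝ (Fin 3)) R}) := by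
  refine (Literature.Probability.LatticeModels.isOpen_nonCoincident 3 n).inter ?_
  simp only [Set.setOf_forall]
  exact isOpen_iInter_of_finite fun i => Metric.isOpen_ball.preimage (continuous_apply i)

/-- **COMPOSITION** (kernel-checked, sorry-free). `(B) → (E) → (U) → BallOrbitComparison.BallLimits`: for each
`R > 0` and `n`, the asymptotic Arzelà–Ascoli theorem with uniqueness
(`Topology.exists_tendstoLocallyUniformlyOn_of_bounded_equicont_unique`) on the open configuration domain
`K_{R,n}` gives a continuous full-filter locally-uniform limit `S_R n`; a choice over `n` assembles
`S_R : CorrFamily 3`. Hypotheses = the stub statements by name (`__Registered.stub_*`), conclusion = the crux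
by name. -/
theorem BallLimits_of :
    __Registered.stub_ballHyperscalingBound → __Registered.stub_ballEquicontinuity →
      __Registered.stub_ballClusterUnique →
      Summit.CriticalPhenomena.Ising3DConformalLimit.Theses.BallOrbitComparison.BallLimits := by
  intro hB hE hU
  dsimp only [__Registered.stub_ballHyperscalingBound, __Registered.stub_ballEquicontinuity,
    __Registered.stub_ballClusterUnique] at hB hE hU
  dsimp only [Summit.CriticalPhenomena.Ising3DConformalLimit.Theses.BallOrbitComparison.BallLimits]
  intro R hR
  choose S hS using fun n =>
    Topology.exists_tendstoLocallyUniformlyOn_of_bounded_equicont_unique (isOpen_ballConfig R n) _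
      (hB R hR n) (hE R hR n) (hU R hR n)
  exact ⟨S, fun n => (hS n).1, fun n => (hS n).2⟩

/-- **The registered stubs discharge the three hypotheses of `BallLimits_of` verbatim** (kernel-checked
`example`, deliberately NOT a named declaration: it depends on the stubs' `sorry`s until they land — then
`BallLimits_of stub_ballHyperscalingBound stub_ballEquicontinuity stub_ballClusterUnique` IS the proof of the
crux). -/
example : Summit.CriticalPhenomena.Ising3DConformalLimit.Theses.BallOrbitComparison.BallLimits :=
  BallLimits_of stub_ballHyperscalingBound stub_ballEquicontinuity stub_ballClusterUnique

/-- **EXACTNESS of the decomposition** (sorry-free): the crux implies all three stub statements — each stub is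
NECESSARY; by the BC3 probes none is sufficient. -/
theorem stubs_of_BallLimits
    (h : Summit.CriticalPhenomena.Ising3DConformalLimit.Theses.BallOrbitComparison.BallLimits) :
    __Registered.stub_ballHyperscalingBound ∧ __Registered.stub_ballEquicontinuity ∧
      __Registered.stub_ballClusterUnique := by
  dsimp only [Summit.CriticalPhenomena.Ising3DConformalLimit.Theses.BallOrbitComparison.BallLimits] at h
  dsimp only [__Registered.stub_ballHyperscalingBound, __Registered.stub_ballEquicontinuity,
    __Registered.stub_ballClusterUnique]
  refine ⟨fun R hR n => ?_, fun R hR n => ?_, fun R hR n => ?_⟩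
  · obtain ⟨S, hS, hSc⟩ := h R hR
    exact Topology.eventually_bounded_of_tendstoLocallyUniformlyOn (isOpen_ballConfig R n) (hS n) (hSc n)
  · obtain ⟨S, hS, hSc⟩ := h R hR
    exact Topology.asympEquicont_of_tendstoLocallyUniformlyOn (isOpen_ballConfig R n) (hS n) (hSc n)
  · obtain ⟨S, hS, -⟩ := h R hR
    exact Topology.clusterUnique_of_tendstoLocallyUniformlyOn (hS n)

/-- The decomposition as one `Iff` (sorry-free): `BallLimits ⟺ (B) ∧ (E) ∧ (U)`. -/
theorem BallLimits_iff_stubs :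
    Summit.CriticalPhenomena.Ising3DConformalLimit.Theses.BallOrbitComparison.BallLimits ↔
      (__Registered.stub_ballHyperscalingBound ∧ __Registered.stub_ballEquicontinuity ∧
        __Registered.stub_ballClusterUnique) :=
  ⟨stubs_of_BallLimits, fun h => BallLimits_of h.1 h.2.1 h.2.2⟩

end Summit.CriticalPhenomena.Ising3DConformalLimit.Cruxes.BallLimits.Birth

end
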